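import Literature.Probability.LatticeModels.TriMeshTriParity
import Literature.Probability.LatticeModels.TriMeshTriGoodColumn
import Literature.Probability.LatticeModels.TriMeshTriWindows
import Literature.Probability.LatticeModels.MeshStrayExtent
import HarnessLib

/-!
# Stray components of the triangular mesh of a Jordan domain have small horizontal extent

Topic: Probability / LatticeModels (triangular twin `TriMesh*` of the "largest mesh component =
bulk" series; sub-namespace `Literature.Probability.LatticeModels.TriMesh`; lattice coordinates of
`TriMeshLattice.lean`: for a Jordan domain `D` the sheared domain `Ω' = triLinear ⁻¹' D.carrier`
carries the square mesh points `meshPoint δ` of the sites, and the graph is H21's triangular mesh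
vertex graph `triMeshVertexGraph D.carrier δ`).

**Theorem** (`JordanDomain.mul_sub_lt_of_triStray`). Let `D` be a Jordan domain and `D₀ > 0`.
There are `ε > 0` and `δ₀ > 0` such that for every mesh `0 < δ < δ₀`: if `x`, `y` are mesh
vertices joined in the triangular mesh graph on mesh vertices, and *every* vertex joined to `x`
has its (square) mesh point at distance `< ε` from `Ω'ᶜ` (the component of `x` is *stray*: it
avoids the `ε`-bulk of the sheared domain), then `δ (y₀ - x₀) < D₀`.

Proof: verbatim port of `MeshStrayExtent.lean`, with the windows of perfect *triangles* of a column
(`TriMeshTriWindows.lean`), the good column provided by the area count on `δ/8`-balls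
(`TriMeshTriGoodColumn.lean`), and the parity theorem `even_windowCrossCount`
(`TriMeshTriParity.lean`) against the odd total `odd_kTriRungCount` (`TriMeshLattice.lean`; the
crossing edges `kcross k n` are exactly the rungs of both kinds, `isKCross_iff_isKTriRung`).

Folklore (no source treats lattice-point counts of mesh components of Jordan domains; this is the
deterministic input of the RSW corollaries `triCrossingProb_lowerBound` / `_upperBound` for the
"largest component" discretisation on `δ𝕋`). Mathlib anchors: `Nat.floor`, `Int.ceil`,
`Finset.Icc`, `List.countP`. H21 anchors: the `TriMeshTri*` files above, `Mesh.odd_kTriRungCount`,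
`JordanDomain.triPreimage` (`TriMeshLattice.lean`), `exists_pos_volume_real_innerCollar_lt`
(`MeshDomainBulk.lean`), `JordanDomain.exterior_joinedIn_of_dist_lt` (`ExteriorULC.lean`).
-/

namespace Literature.Probability.LatticeModels.TriMesh

open Set Metric MeasureTheory Literature.Probability.RandomPlanarGeometry

noncomputable section

variable {Ω : Set ℂ} {δ : ℝ}

/-! ### From walks on mesh vertices to `𝕋`-walks -/

/-- A walk in the triangular mesh graph on mesh vertices is a `𝕋`-walk through mesh vertices
joined to its origin, along mesh edges. [folklore] -/
theorem exists_triWalk {x y : triMeshVertices Ω δ} (P : (triMeshVertexGraph Ω δ).Walk x y) :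
    ∃ W : triGraph.Walk (x : Site 2) (y : Site 2),
      (∀ a ∈ W.support, ∃ ha : a ∈ triMeshVertices Ω δ,
        (triMeshVertexGraph Ω δ).Reachable x ⟨a, ha⟩) ∧
      ∀ d ∈ W.darts, (triMeshGraph Ω δ).Adj d.fst d.snd := by
  induction P with
  | nil =>
    refine ⟨SimpleGraph.Walk.nil, fun a ha => ?_, fun d hd => by simp at hd⟩
    rw [SimpleGraph.Walk.support_nil, List.mem_singleton] at ha
    subst ha
    exact ⟨_, SimpleGraph.Reachable.refl _⟩
  | @cons a b c h P ih =>
    obtain ⟨W, hWs, hWd⟩ := ih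
    have hab : (triMeshGraph Ω δ).Adj (a : Site 2) (b : Site 2) := h
    refine ⟨SimpleGraph.Walk.cons (triMeshGraph_le_triGraph Ω δ hab) W, fun v hv => ?_, fun d hd => ?_⟩
    · rw [SimpleGraph.Walk.support_cons, List.mem_cons] at hv
      rcases hv with rfl | hv
      · exact ⟨a.2, SimpleGraph.Reachable.refl _⟩
      · obtain ⟨hv', hr⟩ := hWs v hv
        exact ⟨hv', h.reachable.trans hr⟩
    · rw [SimpleGraph.Walk.darts_cons, List.mem_cons] at hd
      rcases hd with rfl | hd
      · exact hab
      · exact hWd d hd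

/-- Horizontal separation controls the distance to a triangle centre. [folklore] -/
theorem le_dist_kcenter_of_le_abs {δ c : ℝ} {u : Site 2} {k n : ℤ}
    (h : c ≤ |δ * u 0 - δ * (k + 1 / 2)|) : c ≤ dist (meshPoint δ u) (kcenter δ k n) := by
  rw [Complex.dist_eq]
  refine h.trans ((Complex.abs_re_le_norm _).trans' ?_)
  rw [Complex.sub_re, meshPoint_re, kcenter_re]

/-! ### Corners of a window are joined to any traversed crossing edge -/

/-- In a window `(b, t)` of column `k` (triangles strictly between `b` and `t` perfect) containing
at least one perfect triangle, every corner of every perfect triangle of the window is joined, in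
the mesh graph on mesh vertices, to the left end of any crossing edge `n'` of the window
(`b < n' ≤ t`). [folklore] -/
theorem reachable_corner_of_window (hδ : 0 < δ) {k b t : ℤ}
    (hwin : ∀ i, b < i → i < t → IsPerfect Ω δ k i) {n' : ℤ} (h1 : b < n') (h2 : n' ≤ t)
    (hbt : b + 1 < t) (hl : xL k n' ∈ triMeshVertices Ω δ) {i : ℤ} (hi1 : b < i) (hi2 : i < t)
    {c : Site 2} (hc : IsCorner k i c) :
    ∃ hmem : c ∈ triMeshVertices Ω δ,
      (triMeshVertexGraph Ω δ).Reachable ⟨xL k n', hl⟩ ⟨c, hmem⟩ := by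
  -- the ladder of the run `b + 1, …, t - 1`
  set m : ℕ := (t - b - 2).toNat with hm
  have hm' : (m : ℤ) = t - b - 2 := Int.toNat_of_nonneg (by omega)
  have hrun : ∀ m' : ℕ, m' ≤ m → IsPerfect Ω δ k (b + 1 + m') := fun m' hm'' =>
    hwin _ (by omega) (by omega)
  have hbase : ∀ (m' : ℕ) (hm'' : m' ≤ m) (c' : Site 2) (hc' : IsCorner k (b + 1 + m') c'),
      (triMeshVertexGraph Ω δ).Reachable
        ⟨xL k (b + 1), by simpa using (hrun 0 (Nat.zero_le _)).2 _ (isCorner_xL k (b + 1 + (0 : ℕ)))⟩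
        ⟨c', (hrun m' hm'').2 c' hc'⟩ := fun m' hm'' c' hc' =>
    reachable_of_perfect_run hδ (n₁ := b + 1) hrun hm'' hc'
  -- the target corner
  set mi : ℕ := (i - b - 1).toNat with hmi
  have hmi' : (mi : ℤ) = i - b - 1 := Int.toNat_of_nonneg (by omega)
  have hmin : mi ≤ m := by omega
  have hieq : i = b + 1 + mi := by omega
  have hc' : IsCorner k (b + 1 + mi) c := hieq ▸ hc
  have htarget := hbase mi hmin c hc'
  have hmem : c ∈ triMeshVertices Ω δ := (hrun mi hmin).2 c hc'
  -- the left end of the crossing edge `n'`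
  have hsrc : (triMeshVertexGraph Ω δ).Reachable
      ⟨xL k (b + 1), by simpa using (hrun 0 (Nat.zero_le _)).2 _ (isCorner_xL k (b + 1 + (0 : ℕ)))⟩
      ⟨xL k n', hl⟩ := by
    by_cases hlast : n' = t
    · -- `xL k t` is a corner of the top triangle `t - 1 = b + 1 + m` of the run
      have heq : xL k n' = xL k (b + 1 + m + 1) := by congr 1; omega
      have hcor : IsCorner k (b + 1 + m) (xL k (b + 1 + m + 1)) := isCorner_xL_succ k _
      have hmem' : xL k (b + 1 + m + 1) ∈ triMeshVertices Ω δ := (hrun m le_rfl).2 _ hcor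
      have : (⟨xL k n', hl⟩ : triMeshVertices Ω δ) = ⟨xL k (b + 1 + m + 1), hmem'⟩ := Subtype.ext heq
      rw [this]; exact hbase m le_rfl _ hcor
    · set m' : ℕ := (n' - b - 1).toNat with hm''
      have hm''' : (m' : ℤ) = n' - b - 1 := Int.toNat_of_nonneg (by omega)
      have hm'n : m' ≤ m := by omega
      have heq : xL k n' = xL k (b + 1 + m') := by congr 1; omega
      have hcor : IsCorner k (b + 1 + m') (xL k (b + 1 + m')) := isCorner_xL k _
      have hmem' : xL k (b + 1 + m') ∈ triMeshVertices Ω δ := (hrun m' hm'n).2 _ hcor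
      have : (⟨xL k n', hl⟩ : triMeshVertices Ω δ) = ⟨xL k (b + 1 + m'), hmem'⟩ := Subtype.ext heq
      rw [this]; exact hbase m' hm'n _ hcor
  exact ⟨hmem, hsrc.symm.trans htarget⟩

/-! ### One window of a good column is crossed an even number of times -/

open Classical in
/-- **Evenness, window by window.** In the setting of `even_windowCrossCount` (`D` a Jordan domain,
`η ≤ D₀/16` a modulus of local connectedness of the exterior of the sheared domain at radius
`D₀/16`), let `(b, t)` be a window of column `k`, let `M : ℕ` with `δ M + 8δ < η`, suppose the
column is *good at `b`* (the `M` triangles above `b` are not all perfect with corners within `ε`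
of `Ω'ᶜ`), and let `W` be a `𝕋`-walk through mesh vertices, along mesh edges, all of whose
vertices are joined to a vertex `x` whose whole component is within `ε` of `Ω'ᶜ`, with both ends
at distance `≥ D₀/8` from the centre of triangle `b`. Then `W` traverses the crossing edges
`b < n ≤ t` of column `k` an even number of times: either none is traversed, or the window touches
the component of `x`, so its perfect triangles are shallow and hence fewer than `M` — the window
is short and `even_windowCrossCount` applies. [folklore] -/
theorem even_windowCrossCount_of_good (D : JordanDomain) {δ D₀ η ε : ℝ} (hδ : 0 < δ)
    (hηD : η ≤ D₀ / 16)
    (hulc : ∀ p ∈ (closure (triLinear ⁻¹' D.carrier))ᶜ, ∀ q ∈ (closure (triLinear ⁻¹' D.carrier))ᶜ,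
      dist p q < η → JoinedIn ((closure (triLinear ⁻¹' D.carrier))ᶜ ∩ ball p (D₀ / 16)) p q)
    {k b t : ℤ} (hbt : b < t) (hnb : ¬ IsPerfect D.carrier δ k b) (hnt : ¬ IsPerfect D.carrier δ k t)
    (hwin : ∀ i, b < i → i < t → IsPerfect D.carrier δ k i) {M : ℕ} (hM8 : δ * M + 8 * δ < η)
    (hgood : ¬ ∀ m : ℕ, m < M → IsPerfect D.carrier δ k (b + 1 + m) ∧
      ∀ c, IsCorner k (b + 1 + m) c → infDist (meshPoint δ c) (triLinear ⁻¹' D.carrier)ᶜ < ε)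
    {x : triMeshVertices D.carrier δ}
    (hstray : ∀ z : triMeshVertices D.carrier δ, (triMeshVertexGraph D.carrier δ).Reachable x z →
      infDist (meshPoint δ (z : Site 2)) (triLinear ⁻¹' D.carrier)ᶜ < ε)
    {u v : Site 2} (W : triGraph.Walk u v)
    (hWs : ∀ a ∈ W.support, ∃ ha : a ∈ triMeshVertices D.carrier δ,
      (triMeshVertexGraph D.carrier δ).Reachable x ⟨a, ha⟩)
    (hWd : ∀ d ∈ W.darts, (triMeshGraph D.carrier δ).Adj d.fst d.snd)
    (hu : D₀ / 8 ≤ dist (meshPoint δ u) (kcenter δ k b))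
    (hv : D₀ / 8 ≤ dist (meshPoint δ v) (kcenter δ k b)) :
    Even (W.edges.countP fun e => decide (∃ n, b < n ∧ n ≤ t ∧ e = kcross k n)) := by
  by_cases hzero : (W.edges.countP fun e => decide (∃ n, b < n ∧ n ≤ t ∧ e = kcross k n)) = 0
  · rw [hzero]; exact ⟨0, rfl⟩
  obtain ⟨e, he, hpe⟩ := List.countP_pos_iff.1 (Nat.pos_of_ne_zero hzero)
  simp only [decide_eq_true_eq] at hpe
  obtain ⟨n', hn'1, hn'2, hen⟩ := hpe
  have he' : s(xL k n', xR k n') ∈ W.edges := by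
    rw [hen, kcross] at he; exact he
  obtain ⟨hl, hreachl⟩ := hWs (xL k n') (W.fst_mem_support_of_mem_edges he')
  -- the window is short
  have hshortZ : t - b ≤ M := by
    by_contra hlong
    push Not at hlong
    apply hgood
    intro m hm
    have hmZ : (m : ℤ) < M := by exact_mod_cast hm
    refine ⟨hwin _ (by omega) (by omega), fun c hc => ?_⟩
    obtain ⟨hmem, hr⟩ := reachable_corner_of_window hδ hwin hn'1 hn'2 (by omega) hl
      (i := b + 1 + m) (by omega) (by omega) hc
    exact hstray ⟨c, hmem⟩ (hreachl.trans hr)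
  have hshort : δ * (t - b) / 2 + 8 * δ < η := by
    have : δ * ((t : ℝ) - b) ≤ δ * M :=
      mul_le_mul_of_nonneg_left (by exact_mod_cast hshortZ) hδ.le
    have hnn : 0 ≤ δ * ((t : ℝ) - b) := mul_nonneg hδ.le (by
      have : (b : ℝ) < t := by exact_mod_cast hbt
      linarith)
    linarith
  exact even_windowCrossCount D hδ hηD hulc hbt hnb hnt hshort W (fun a ha => (hWs a ha).1) hWd hu hv

/-! ### A good column is crossed an even number of times -/

open Classical in
/-- **All windows at once.** In the setting of `even_windowCrossCount_of_good`, if the column `k`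
is good at *every* index (no `M` consecutive shallow perfect triangles anywhere) and both ends of
`W` are at horizontal distance `≥ 3D₀/8` from the midline `re z = δ(k + ½)`, then `W` traverses
the rungs of column `k` (of both kinds) an even number of times: group the crossing edges by
windows (`countP_isKCross_eq_sum`) and apply `even_windowCrossCount_of_good` to each window.
[folklore] -/
theorem even_kTriRungCount_of_good (D : JordanDomain) {δ D₀ η ε : ℝ} (hδ : 0 < δ) (hD₀ : 0 < D₀)
    (hηD : η ≤ D₀ / 16)
    (hulc : ∀ p ∈ (closure (triLinear ⁻¹' D.carrier))ᶜ, ∀ q ∈ (closure (triLinear ⁻¹' D.carrier))ᶜ,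
      dist p q < η → JoinedIn ((closure (triLinear ⁻¹' D.carrier))ᶜ ∩ ball p (D₀ / 16)) p q)
    {k : ℤ} {M : ℕ} (hM8 : δ * M + 8 * δ < η)
    (hgood : ∀ j : ℤ, ¬ ∀ m : ℕ, m < M → IsPerfect D.carrier δ k (j + 1 + m) ∧
      ∀ c, IsCorner k (j + 1 + m) c → infDist (meshPoint δ c) (triLinear ⁻¹' D.carrier)ᶜ < ε)
    {x : triMeshVertices D.carrier δ}
    (hstray : ∀ z : triMeshVertices D.carrier δ, (triMeshVertexGraph D.carrier δ).Reachable x z →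
      infDist (meshPoint δ (z : Site 2)) (triLinear ⁻¹' D.carrier)ᶜ < ε)
    {u v : Site 2} (W : triGraph.Walk u v)
    (hWs : ∀ a ∈ W.support, ∃ ha : a ∈ triMeshVertices D.carrier δ,
      (triMeshVertexGraph D.carrier δ).Reachable x ⟨a, ha⟩)
    (hWd : ∀ d ∈ W.darts, (triMeshGraph D.carrier δ).Adj d.fst d.snd)
    (hu : 3 * D₀ / 8 ≤ |δ * u 0 - δ * (k + 1 / 2)|) (hv : 3 * D₀ / 8 ≤ |δ * v 0 - δ * (k + 1 / 2)|) :
    Even (Mesh.kTriRungCount k W) := by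
  have hΩb : Bornology.IsBounded (triLinear ⁻¹' D.carrier) := D.triPreimage.isBounded
  -- windows of the column, and the sum decomposition
  choose wb wt hwb hwt hnb hnt hwin using fun j => exists_window (Ω := D.carrier) hΩb hδ k j
  set HB : Finset ℤ := (W.support.map fun a => a 1).toFinset with hHB
  set NB : Finset ℤ := HB.image (fun h => 2 * h) ∪ HB.image (fun h => 2 * h - 1) with hNB
  set B : Finset ℤ := NB.image wb with hB
  have hBkey : ∀ e ∈ W.edges, ∀ n, e = kcross k n → wb n ∈ B := by
    intro e he n hen
    have he' : s(xL k n, xR k n) ∈ W.edges := by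
      rw [hen, kcross] at he; exact he
    refine Finset.mem_image.2 ⟨n, ?_, rfl⟩
    have hmem : cTop n ∈ HB := by
      rw [hHB, List.mem_toFinset, List.mem_map]
      exact ⟨xL k n, W.fst_mem_support_of_mem_edges he', rfl⟩
    rw [hNB, Finset.mem_union, Finset.mem_image, Finset.mem_image]
    have e1 := two_mul_cBot_add n
    rcases emod_two_eq n with h | h
    · left; exact ⟨cTop n, hmem, by rw [cTop_eq]; omega⟩
    · right; exact ⟨cTop n, hmem, by rw [cTop_eq]; omega⟩
  have hsum := countP_isKCross_eq_sum k wb B W.edges hBkey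
  -- every window met is crossed an even number of times
  have heven : ∀ b ∈ B, Even (W.edges.countP fun e => decide (∃ n, e = kcross k n ∧ wb n = b)) := by
    intro b hb
    obtain ⟨j₁, -, rfl⟩ := Finset.mem_image.1 hb
    have hiff : ∀ e, (∃ n, e = kcross k n ∧ wb n = wb j₁) ↔
        ∃ n, wb j₁ < n ∧ n ≤ wt j₁ ∧ e = kcross k n := by
      intro e
      constructor
      · rintro ⟨n, rfl, hn⟩
        have ht : wt n = wt j₁ := by
          by_contra hne'
          rcases lt_or_gt_of_ne hne' with h | h
          · exact hnt n (hwin j₁ (wt n) (by rw [← hn]; exact (hwb n).trans_le (hwt n)) h)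
          · exact hnt j₁ (hwin n (wt j₁) (by rw [hn]; exact (hwb j₁).trans_le (hwt j₁)) h)
        exact ⟨n, hn ▸ hwb n, ht ▸ hwt n, rfl⟩
      · rintro ⟨n, h1, h2, rfl⟩
        exact ⟨n, rfl, (window_eq_of_mem (hnb n) (hnt n) (hwin n) (hnb j₁) (hnt j₁) (hwin j₁)
          (hwb n) (hwt n) h1 h2).1⟩
    have hcongr : (W.edges.countP fun e => decide (∃ n, e = kcross k n ∧ wb n = wb j₁)) =
        W.edges.countP fun e => decide (∃ n, wb j₁ < n ∧ n ≤ wt j₁ ∧ e = kcross k n) :=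
      List.countP_congr fun e _ => by simp only [hiff e]
    rw [hcongr]
    exact even_windowCrossCount_of_good D hδ hηD hulc ((hwb j₁).trans_le (hwt j₁)) (hnb j₁) (hnt j₁)
      (hwin j₁) hM8 (hgood (wb j₁)) hstray W hWs hWd
      (le_dist_kcenter_of_le_abs (by linarith [hu])) (le_dist_kcenter_of_le_abs (by linarith [hv]))
  have hcongr' : Mesh.kTriRungCount k W = W.edges.countP fun e => decide (IsKCross k e) := by
    unfold Mesh.kTriRungCount
    exact List.countP_congr fun e _ => by simp only [isKCross_iff_isKTriRung]
  rw [hcongr', hsum]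
  exact Finset.even_sum _ fun b hb => heven b hb

/-! ### Choosing the constants and the good column -/

/-- **Arithmetic of the good column.** Given the scales (`0 < δ`, `δ < η/64`, `δ < D₀/64`,
`δ ≤ r/4`), two integers `x0 ≤ y0` with `D₀ ≤ δ (y0 - x0)`, and the area bound
`area {z ∈ Ω' | infDist z Ω'ᶜ < r} < D₀ η area(B(0,1)) / 32768` for the sheared domain
`Ω' = triLinear ⁻¹' Ω`, there are a column `k` strictly between them, at horizontal distance
`≥ 3D₀/8` from both, and `M : ℕ` with `δ M + 8δ < η`, such that column `k` contains no `M`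
consecutive perfect triangles with all corners within `r/2` of `Ω'ᶜ`. [folklore] -/
theorem exists_goodColumn {Ω : Set ℂ} (hΩb : Bornology.IsBounded (triLinear ⁻¹' Ω)) {δ η D₀ r : ℝ}
    (hδ : 0 < δ) (hη : 0 < η) (hD₀ : 0 < D₀) (hδη : δ < η / 64) (hδD : δ < D₀ / 64) (hδr : δ ≤ r / 4)
    (hcollar : volume.real {z ∈ triLinear ⁻¹' Ω | infDist z (triLinear ⁻¹' Ω)ᶜ < r} <
      D₀ * η * volume.real (ball (0 : ℂ) 1) / 32768)
    {x0 y0 : ℤ} (hge : D₀ ≤ δ * (y0 - x0)) :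
    ∃ (k : ℤ) (M : ℕ), x0 ≤ k ∧ k + 1 ≤ y0 ∧ 3 * D₀ / 8 ≤ |δ * x0 - δ * (k + 1 / 2)| ∧
      3 * D₀ / 8 ≤ |δ * y0 - δ * (k + 1 / 2)| ∧ δ * M + 8 * δ < η ∧
      ∀ j : ℤ, ¬ ∀ m : ℕ, m < M → IsPerfect Ω δ k (j + 1 + m) ∧
        ∀ c, IsCorner k (j + 1 + m) c → infDist (meshPoint δ c) (triLinear ⁻¹' Ω)ᶜ < r / 2 := by
  set v : ℝ := volume.real (ball (0 : ℂ) 1) with hv_def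
  have hv : 0 < v :=
    ENNReal.toReal_pos (measure_ball_pos volume (0 : ℂ) one_pos).ne' measure_ball_lt_top.ne
  -- the run length `M`
  set M : ℕ := ⌊η / (16 * δ)⌋₊ with hM
  have hMle : (M : ℝ) ≤ η / (16 * δ) := Nat.floor_le (by positivity)
  have hMlt : η / (16 * δ) < M + 1 := Nat.lt_floor_add_one _
  have hkey : η / (16 * δ) * δ = η / 16 := by
    field_simp
  have hM1 : (M : ℝ) * δ ≤ η / 16 := by
    calc (M : ℝ) * δ ≤ η / (16 * δ) * δ := mul_le_mul_of_nonneg_right hMle hδ.le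
      _ = η / 16 := hkey
  have hM2 : η / 32 ≤ (M : ℝ) * δ := by
    have := mul_lt_mul_of_pos_right hMlt hδ
    rw [hkey] at this
    linarith
  have hM8 : δ * M + 8 * δ < η := by linarith
  -- the column range
  set L : ℤ := ⌈3 * D₀ / (8 * δ)⌉ with hL
  have hL1 : 3 * D₀ / (8 * δ) ≤ L := Int.le_ceil _
  have hL2 : (L : ℝ) < 3 * D₀ / (8 * δ) + 1 := Int.ceil_lt_add_one _
  have hq : 0 < D₀ / (8 * δ) := by positivity
  have h38 : 3 * D₀ / (8 * δ) = 3 * (D₀ / (8 * δ)) := by ring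
  have hDδ : D₀ / δ = 8 * (D₀ / (8 * δ)) := by
    field_simp
  have hL0 : (0 : ℤ) ≤ L := by
    have : (0 : ℝ) < L := lt_of_lt_of_le (by positivity) hL1
    exact_mod_cast this.le
  set Kset : Finset ℤ := Finset.Icc (x0 + L + 1) (y0 - L - 1) with hKset
  have hyx : D₀ / δ ≤ (y0 : ℝ) - x0 := by rw [div_le_iff₀ hδ]; linarith
  have hD8 : 8 ≤ D₀ / (8 * δ) := by rw [le_div_iff₀ (by positivity)]; linarith
  have hcard : D₀ / (8 * δ) ≤ (Kset.card : ℝ) := by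
    rw [hKset, Int.card_Icc]
    have h1 : ((y0 - L - 1 + 1 - (x0 + L + 1) : ℤ) : ℝ) ≤ ((y0 - L - 1 + 1 - (x0 + L + 1)).toNat : ℝ) := by
      exact_mod_cast Int.self_le_toNat _
    push_cast at h1
    rw [h38] at hL2
    rw [hDδ] at hyx
    linarith
  -- the area inequality and the good column
  have harea : volume.real {z ∈ triLinear ⁻¹' Ω | infDist z (triLinear ⁻¹' Ω)ᶜ < r / 2 + 2 * δ} <
      Kset.card * M * ((δ / 8) ^ 2 * v) := by
    have hmono : volume.real {z ∈ triLinear ⁻¹' Ω | infDist z (triLinear ⁻¹' Ω)ᶜ < r / 2 + 2 * δ} ≤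
        volume.real {z ∈ triLinear ⁻¹' Ω | infDist z (triLinear ⁻¹' Ω)ᶜ < r} :=
      measureReal_mono (fun z hz => ⟨hz.1, hz.2.trans_le (by linarith)⟩)
        (hΩb.subset fun z hz => hz.1).measure_lt_top.ne
    have hM3 : η / (32 * δ) ≤ M := by rw [div_le_iff₀ (by positivity)]; linarith
    have h1 : D₀ / (8 * δ) * (η / (32 * δ)) ≤ (Kset.card : ℝ) * M :=
      mul_le_mul hcard hM3 (by positivity) (by positivity)
    have h2 : D₀ / (8 * δ) * (η / (32 * δ)) * ((δ / 8) ^ 2 * v) = D₀ * η * v / 16384 := by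
      field_simp
      ring
    have hlow : D₀ * η * v / 16384 ≤ Kset.card * M * ((δ / 8) ^ 2 * v) := by
      rw [← h2]; exact mul_le_mul_of_nonneg_right h1 (by positivity)
    have : D₀ * η * v / 32768 < D₀ * η * v / 16384 := by
      have := mul_pos (mul_pos hD₀ hη) hv; linarith
    linarith
  obtain ⟨k, hk, hgood⟩ := exists_column_forall_not_shallowRun hΩb hδ Kset M harea
  rw [hKset, Finset.mem_Icc] at hk
  obtain ⟨hk1, hk2⟩ := hk
  have hk1' : (x0 : ℝ) + L + 1 ≤ k := by exact_mod_cast hk1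
  have hk2' : (k : ℝ) ≤ y0 - L - 1 := by exact_mod_cast hk2
  have hLD : 3 * D₀ / 8 ≤ δ * L := by
    have : δ * (3 * D₀ / (8 * δ)) = 3 * D₀ / 8 := by
      field_simp
    rw [← this]
    exact mul_le_mul_of_nonneg_left hL1 hδ.le
  refine ⟨k, M, by omega, by omega, ?_, ?_, hM8, hgood⟩
  · rw [abs_sub_comm, abs_of_nonneg (by nlinarith)]; nlinarith
  · rw [abs_of_nonneg (by nlinarith)]; nlinarith

/-! ### The theorem -/

/-- **Stray components of the triangular mesh have horizontal extent `< D₀`.** See the module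
docstring (lattice coordinates: `x₀` is the first lattice coordinate, distances to `Ω'ᶜ` are
measured from the square mesh points in the sheared domain `Ω' = triLinear ⁻¹' D.carrier`).
[folklore] -/
theorem _root_.Literature.Probability.RandomPlanarGeometry.JordanDomain.mul_sub_lt_of_triStray
    (D : JordanDomain) {D₀ : ℝ} (hD₀ : 0 < D₀) :
    ∃ ε > 0, ∃ δ₀ > 0, ∀ δ : ℝ, 0 < δ → δ < δ₀ →
      ∀ (x y : triMeshVertices D.carrier δ), (triMeshVertexGraph D.carrier δ).Reachable x y →
        (∀ z : triMeshVertices D.carrier δ, (triMeshVertexGraph D.carrier δ).Reachable x z →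
          infDist (meshPoint δ (z : Site 2)) (triLinear ⁻¹' D.carrier)ᶜ < ε) →
        δ * ((y : Site 2) 0 - (x : Site 2) 0) < D₀ := by
  set D' := D.triPreimage with hD'
  have hΩo : IsOpen (triLinear ⁻¹' D.carrier) := D'.isOpen
  have hΩb : Bornology.IsBounded (triLinear ⁻¹' D.carrier) := D'.isBounded
  have hne : (triLinear ⁻¹' D.carrier)ᶜ.Nonempty := by
    by_contra h
    rw [not_nonempty_iff_eq_empty, compl_empty_iff] at h
    exact NormedSpace.unbounded_univ ℝ ℂ (h ▸ hΩb)
  -- uniform local connectedness of the exterior of the sheared domain at radius `D₀/16`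
  obtain ⟨η₀, hη₀, hulc₀⟩ := D'.exterior_joinedIn_of_dist_lt (show 0 < D₀ / 16 by positivity)
  set η := min η₀ (D₀ / 16) with hηdef
  have hη : 0 < η := lt_min hη₀ (by positivity)
  have hηD : η ≤ D₀ / 16 := min_le_right _ _
  have hulc : ∀ a ∈ (closure (triLinear ⁻¹' D.carrier))ᶜ, ∀ b ∈ (closure (triLinear ⁻¹' D.carrier))ᶜ,
      dist a b < η → JoinedIn ((closure (triLinear ⁻¹' D.carrier))ᶜ ∩ ball a (D₀ / 16)) a b :=
    fun a ha b hb hab => hulc₀ a ha b hb (hab.trans_le (min_le_left _ _))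
  -- the area budget
  have hv : 0 < volume.real (ball (0 : ℂ) 1) :=
    ENNReal.toReal_pos (measure_ball_pos volume (0 : ℂ) one_pos).ne' measure_ball_lt_top.ne
  have hApos : 0 < D₀ * η * volume.real (ball (0 : ℂ) 1) / 32768 := by positivity
  obtain ⟨r, hr, hcollar⟩ := exists_pos_volume_real_innerCollar_lt hΩo hΩb hne hApos
  refine ⟨r / 2, by positivity, min (r / 4) (min (η / 64) (D₀ / 64)), by positivity, ?_⟩
  intro δ hδ hδlt x y hreach hstray
  have hδr : δ ≤ r / 4 := hδlt.le.trans (min_le_left _ _)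
  have hδη : δ < η / 64 := hδlt.trans_le ((min_le_right _ _).trans (min_le_left _ _))
  have hδD : δ < D₀ / 64 := hδlt.trans_le ((min_le_right _ _).trans (min_le_right _ _))
  by_contra hge
  push Not at hge
  obtain ⟨k, M, hk1, hk2, hxfar, hyfar, hM8, hgood⟩ :=
    exists_goodColumn hΩb hδ hη hD₀ hδη hδD hδr hcollar hge
  -- the walk: odd and even crossing counts
  obtain ⟨P⟩ := hreach
  obtain ⟨W, hWs, hWd⟩ := exists_triWalk P
  have hodd : Odd (Mesh.kTriRungCount k W) := Mesh.odd_kTriRungCount k W hk1 hk2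
  have heven : Even (Mesh.kTriRungCount k W) :=
    even_kTriRungCount_of_good D hδ hD₀ hηD hulc hM8 hgood hstray W hWs hWd hxfar hyfar
  exact (Nat.not_even_iff_odd.2 hodd) heven

end

end Literature.Probability.LatticeModels.TriMesh
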